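import Summits.Ventures.YMGap.RobustBall.Targets
import Summits.Ventures.YMGap.RobustBall.TermPerturbation
import Summits.Ventures.YMGap.RobustBall.RectangleCode
import HarnessLib

/-!
# RobustBall/RectangleWitness — T0.2 witness (w1): the `1×2`-rectangle action is a member of the tier-1 ball
(cell `pub-ymgap`, track Y2 ROBUST-BALL; p1)

HONEST FRAMING: a MEMBERSHIP CERTIFICATE for one concrete non-Wilson member of the robust ball of
`RobustBall/Defs` (the Symanzik / Lüscher–Weisz `1×2`-rectangle term `τ Σ_r (1 − Re tr U_∂r/N)`): finite-torus
bookkeeping only — no expansion, no continuum, no Clay claim. It discharges `RectangleWitnessTargetC N d` of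
`RobustBall/Targets` AS TYPED (the landed, site-based incidence; rb-theory ruling 2026-08-22T20:54Z): for every torus
`L ≥ 3` the rectangle action is a `Perturbation d L N` with the typed total, lies in
`ClusterDomainFR (12(d−1)|τ|) (30d(d−1)|τ|/√N) 2`, and is slab-local with vertical dependence diameter `2`.

Construction: the loop family `rectFamily` indexed by `(x, (i, j))`, `i ≠ j`, with word = the six letters of
`rectangleHolonomy U x i j 1 2` and polymer `rectCode x i j` (`RobustBall/RectangleCode`); the generic assembly and
load formulas of `RobustBall/TermPerturbation`; the counts `Σ_r mult_r(e) = 6(d−1)` (two letter positions in direction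
`e.2` as short side, four as long side, `d − 1` choices of the other direction each), `|w_r| = 6`, and at most
`5 · d(d−1)` rectangles whose polymer contains a given site.
-/

noncomputable section

open MeasureTheory Finset Function
open Literature.Probability.LatticeModels Literature.Probability.LatticeModels.DobrushinMetric
open Literature.MathematicalPhysics.QuantumLattice hiding torusNorm
open Literature.MathematicalPhysics.QuantumFieldTheory hiding ZdEdge

namespace Summit.Ventures.YMGap.RobustBall

variable {d L N : ℕ}

/-! ### The rectangle word -/

/-- The six letters of the based `1×2` rectangle `(x; i, j)`: `(x,i)⁺ (x+e_i,j)⁺ (x+e_i+e_j,j)⁺ (x+2e_j,i)⁻ (x+e_j,j)⁻ (x,j)⁻`.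
[folklore] -/
def rectWord (x : Site d L) (i j : Fin d) : List (Letter d L) :=
  [⟨x, i, false⟩, ⟨x + unitVec i, j, false⟩, ⟨x + unitVec i + unitVec j, j, false⟩,
    ⟨x + unitVec j + unitVec j, i, true⟩, ⟨x + unitVec j, j, true⟩, ⟨x, j, true⟩]

/-- The rectangle word has six letters. [folklore] -/
@[simp] theorem length_rectWord (x : Site d L) (i j : Fin d) : (rectWord x i j).length = 6 := rfl

/-- **The word holonomy is the tree's rectangle holonomy** `rectangleHolonomy U x i j 1 2`. [folklore] -/
theorem wordProd_rectWord {G : Type*} [Group G] (U : GaugeConfig d L G) (x : Site d L) (i j : Fin d) :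
    wordProd (rectWord x i j) U = rectangleHolonomy U x i j 1 2 := by
  have hx2 : x + Pi.single j (2 : ZMod L) = x + (Pi.single j 1 : Site d L) + Pi.single j 1 := by
    rw [add_assoc, ← Pi.single_add]; norm_num
  simp only [rectWord, wordProd_cons, wordProd_nil, Letter.hol, Letter.edge, Bool.false_eq_true, if_false, if_true,
    rectangleHolonomy, lineHolonomy, Literature.MathematicalPhysics.QuantumFieldTheory.Site.shift, unitVec, Nat.cast_one, Nat.cast_ofNat,
    hx2, mul_one, mul_inv_rev, mul_assoc]

/-- The loop activity of the rectangle word is the tree's `rectangleActivity`. [folklore] -/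
theorem loopActivity_rectWord (τ : ℝ) (x : Site d L) (i j : Fin d) (U : GaugeConfig d L (SUN N)) :
    loopActivity N τ (rectWord x i j) U = rectangleActivity N τ x i j U := by
  rw [loopActivity, rectangleActivity, wordProd_rectWord]

/-- The rectangle word is a closed walk based at `x`. [folklore] -/
theorem isWalk_rectWord (x : Site d L) (i j : Fin d) : IsWalk x (rectWord x i j) x := by
  simp [rectWord, IsWalk, Letter.src, Letter.tgt, Literature.MathematicalPhysics.QuantumFieldTheory.Site.shift, unitVec, add_comm,
    add_left_comm]

/-- Every letter of the rectangle word is based in the rectangle code. [folklore] -/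
theorem site_mem_rectCode {x : Site d L} {i j : Fin d} {l : Letter d L} (hl : l ∈ rectWord x i j) :
    l.site ∈ rectCode x i j := by
  simp only [rectWord, List.mem_cons, List.mem_nil_iff, or_false] at hl
  rcases hl with rfl | rfl | rfl | rfl | rfl | rfl <;> simp [rectCode]

/-- **Balance**: every centre slab is crossed as often upwards as downwards (`i ≠ j`). [folklore] -/
theorem netCount_rectWord {x : Site d L} {i j : Fin d} (hij : i ≠ j) (v : Fin d) (t : ZMod L) :
    netCount (rectWord x i j) v t = 0 := by
  simp only [netCount, rectWord, List.map_cons, List.map_nil, List.sum_cons, List.sum_nil, Bool.false_eq_true,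
    if_false, if_true, add_zero]
  by_cases hvi : i = v
  · subst hvi
    simp only [true_and, hij.symm, false_and, if_false, add_zero, zero_add, Pi.add_apply,
      unitVec_apply_of_ne hij]
    split_ifs <;> norm_num
  · by_cases hvj : j = v
    · subst hvj
      simp only [true_and, hvi, false_and, if_false, add_zero, zero_add, Pi.add_apply,
        unitVec_apply_of_ne (Ne.symm hij), unitVec_apply_self]
      split_ifs <;> norm_num
    · simp [hvi, hvj]

/-- **Vertical window `2`**: in every direction the letters sit at two consecutive heights (`i ≠ j`). [folklore] -/
theorem window_rectWord {x : Site d L} {i j : Fin d} (hij : i ≠ j) (v : Fin d) :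
    ∃ t₀ : ZMod L, ∀ l ∈ rectWord x i j, l.dir = v → ∃ k : ℕ, k < 2 ∧ l.site v = t₀ + k := by
  by_cases hvi : v = i
  · subst hvi
    refine ⟨x v, fun l hl hlv => ?_⟩
    simp only [rectWord, List.mem_cons, List.mem_nil_iff, or_false] at hl
    rcases hl with rfl | rfl | rfl | rfl | rfl | rfl
    · exact ⟨0, by norm_num, by simp⟩
    · exact absurd hlv (Ne.symm hij)
    · exact absurd hlv (Ne.symm hij)
    · exact ⟨0, by norm_num, by simp [unitVec_apply_of_ne hij]⟩
    · exact absurd hlv (Ne.symm hij)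
    · exact absurd hlv (Ne.symm hij)
  · by_cases hvj : v = j
    · subst hvj
      refine ⟨x v, fun l hl hlv => ?_⟩
      simp only [rectWord, List.mem_cons, List.mem_nil_iff, or_false] at hl
      rcases hl with rfl | rfl | rfl | rfl | rfl | rfl
      · exact absurd hlv.symm hvi
      · exact ⟨0, by norm_num, by simp [unitVec_apply_of_ne (Ne.symm hij)]⟩
      · exact ⟨1, by norm_num, by simp [unitVec_apply_of_ne (Ne.symm hij)]⟩
      · exact absurd hlv.symm hvi
      · exact ⟨1, by norm_num, by simp⟩
      · exact ⟨0, by norm_num, by simp⟩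
    · refine ⟨0, fun l hl hlv => ?_⟩
      simp only [rectWord, List.mem_cons, List.mem_nil_iff, or_false] at hl
      rcases hl with rfl | rfl | rfl | rfl | rfl | rfl
      all_goals first | exact absurd hlv.symm hvi | exact absurd hlv.symm hvj

/-- The multiplicity of a link in the rectangle word, letter by letter (in the order produced by `mult_cons`).
[folklore] -/
theorem mult_rectWord (x : Site d L) (i j : Fin d) (e : Edge d L) :
    mult (rectWord x i j) e =
      (if (x, j) = e then 1 else 0) + (if (x + unitVec j, j) = e then 1 else 0) +
        (if (x + unitVec j + unitVec j, i) = e then 1 else 0) + (if (x + unitVec i + unitVec j, j) = e then 1 else 0) +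
        (if (x + unitVec i, j) = e then 1 else 0) + (if (x, i) = e then 1 else 0) := by
  simp only [rectWord, mult_cons, mult_nil, Letter.edge, zero_add]
  split_ifs <;> rfl

/-! ### The rectangle family and its counts -/

section Family

variable (N : ℕ) (τ : ℝ)

variable (d L) in
/-- The family of LOOP TERMS of all based `1×2` rectangles `(x; i, j)`, `i ≠ j`, coefficient `τ`, each on its own
polymer `rectCode x i j`. [folklore] -/
def rectFamily (r : Site d L × DirPair d) : LocalTerm d L N :=
  LocalTerm.ofLoop N τ (rectWord r.1 r.2.1.1 r.2.1.2) (rectCode r.1 r.2.1.1 r.2.1.2) r.1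
    (isWalk_rectWord r.1 r.2.1.1 r.2.1.2) fun _ hl => site_mem_rectCode hl

/-- The activity of a rectangle term is the tree's `rectangleActivity`. [folklore] -/
theorem rectFamily_act (r : Site d L × DirPair d) (U : GaugeConfig d L (SUN N)) :
    (rectFamily d L N τ r).act U = rectangleActivity N τ r.1 r.2.1.1 r.2.1.2 U :=
  loopActivity_rectWord τ r.1 _ _ U

/-- The letters of a rectangle term. [folklore] -/
@[simp] theorem rectFamily_letters (r : Site d L × DirPair d) :
    (rectFamily d L N τ r).letters = rectWord r.1 r.2.1.1 r.2.1.2 := rfl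

/-- The polymer of a rectangle term. [folklore] -/
@[simp] theorem rectFamily_code (r : Site d L × DirPair d) :
    (rectFamily d L N τ r).code = rectCode r.1 r.2.1.1 r.2.1.2 := rfl

/-- The oscillation constant of a rectangle term. [folklore] -/
@[simp] theorem rectFamily_oscC (r : Site d L × DirPair d) : (rectFamily d L N τ r).oscC = 2 * |τ| := rfl

/-- The Lipschitz constant of a rectangle term. [folklore] -/
@[simp] theorem rectFamily_lipC (r : Site d L × DirPair d) :
    (rectFamily d L N τ r).lipC = |τ| / Real.sqrt N := rfl

/-- For `3 ≤ L` distinct rectangles have distinct polymers. [folklore] -/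
theorem rectFamily_code_injective (hL : 3 ≤ L) : Function.Injective fun r => (rectFamily d L N τ r).code := by
  rintro ⟨x, ⟨i, j⟩, hij⟩ ⟨x', ⟨i', j'⟩, hij'⟩ h
  obtain ⟨rfl, rfl, rfl⟩ := rectCode_injective hL hij hij' h
  rfl

variable [NeZero L]

/-- **The letter count through a link**: `Σ_r mult_{w_r}(e) = 6(d − 1)` (two short-side positions and four long-side
positions, `d − 1` choices of the other direction each). [folklore] -/
theorem sum_mult_rectFamily (e : Edge d L) :
    ∑ r : Site d L × DirPair d, mult (rectWord r.1 r.2.1.1 r.2.1.2) e = 6 * (d - 1) := by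
  have h1 := sum_dirPair_ite_fst_eq (d := d) e.2
  have h2 := sum_dirPair_ite_snd_eq (d := d) e.2
  simp only [mult_rectWord, Fintype.sum_prod_type_right, sum_add_distrib, add_assoc,
    sum_ite_site_eq, sum_ite_translate_eq, h1, h2]
  omega

/-- The letter count through a link, over `ℝ`: `Σ_r mult_{w_r}(e) = 6(d − 1)`. [folklore] -/
theorem sum_mult_rectFamily_real (e : Edge d L) :
    ∑ r : Site d L × DirPair d, (mult (rectWord r.1 r.2.1.1 r.2.1.2) e : ℝ) = 6 * ((d : ℝ) - 1) := by
  have hd : 1 ≤ d := Nat.succ_le_of_lt (Fin.pos e.2)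
  have h := sum_mult_rectFamily e
  have h' : ((∑ r : Site d L × DirPair d, mult (rectWord r.1 r.2.1.1 r.2.1.2) e : ℕ) : ℝ) =
      ((6 * (d - 1) : ℕ) : ℝ) := by rw [h]
  push_cast [Nat.cast_sub hd] at h'
  exact h'

/-- At most five base points `x` put a given site into the rectangle code `rectCode x i j`. [folklore] -/
theorem card_filter_mem_rectCode_le (y : Site d L) (i j : Fin d) :
    (univ.filter fun x : Site d L => y ∈ rectCode x i j).card ≤ 5 := by
  have hsub : (univ.filter fun x : Site d L => y ∈ rectCode x i j) ⊆
      {y, y - unitVec i, y - unitVec j, y - unitVec i - unitVec j, y - unitVec j - unitVec j} := by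
    intro x hx
    simp only [mem_filter, mem_univ, true_and, rectCode, mem_insert, mem_singleton] at hx
    simp only [mem_insert, mem_singleton]
    rcases hx with rfl | rfl | rfl | rfl | rfl
    · exact Or.inl rfl
    · exact Or.inr (Or.inl (by abel))
    · exact Or.inr (Or.inr (Or.inl (by abel)))
    · exact Or.inr (Or.inr (Or.inr (Or.inl (by abel))))
    · exact Or.inr (Or.inr (Or.inr (Or.inr (by abel))))
  refine (card_le_card hsub).trans ?_
  refine (card_insert_le _ _).trans (Nat.succ_le_succ ((card_insert_le _ _).trans (Nat.succ_le_succ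
    ((card_insert_le _ _).trans (Nat.succ_le_succ ((card_insert_le _ _).trans (Nat.succ_le_succ ?_)))))))
  simp

/-- `#{(i, j) : i ≠ j} = d(d − 1)`. [folklore] -/
theorem card_dirPair : Fintype.card (DirPair d) = d * (d - 1) := by
  rw [Fintype.card_subtype]
  have : (univ.filter fun p : Fin d × Fin d => p.1 ≠ p.2) = (univ : Finset (Fin d)).offDiag := by
    ext p; simp [Finset.mem_offDiag]
  rw [this, Finset.offDiag_card, card_univ, Fintype.card_fin, Nat.mul_sub_one]

/-- **The site count** (landed, site-based incidence): the Lipschitz mass of all rectangles whose polymer contains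
the base site of `e`: `Σ_{r : e.1 ∈ code r} (|τ|/√N)·|w_r| ≤ (|τ|/√N) · 6 · 5 · d(d−1) = 30 d (d − 1)|τ|/√N`.
[folklore] -/
theorem sum_site_rectFamily_le (e : Edge d L) :
    ∑ r, (if e.1 ∈ (rectFamily d L N τ r).code then
        (rectFamily d L N τ r).lipC * ((rectFamily d L N τ r).letters.length : ℝ) else 0) ≤
      30 * (d : ℝ) * ((d : ℝ) - 1) * |τ| / Real.sqrt N := by
  have hd : 1 ≤ d := Nat.succ_le_of_lt (Fin.pos e.2)
  have hc : 0 ≤ |τ| / Real.sqrt N := by positivity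
  have hinner : ∀ p : DirPair d,
      ∑ x : Site d L, (if e.1 ∈ rectCode x p.1.1 p.1.2 then |τ| / Real.sqrt N * (6 : ℝ) else 0) ≤
        30 * (|τ| / Real.sqrt N) := by
    intro p
    rw [← sum_filter, sum_const, nsmul_eq_mul]
    have := card_filter_mem_rectCode_le (e.1) p.1.1 p.1.2
    have : ((univ.filter fun x : Site d L => e.1 ∈ rectCode x p.1.1 p.1.2).card : ℝ) ≤ 5 := by exact_mod_cast this
    nlinarith
  calc ∑ r, (if e.1 ∈ (rectFamily d L N τ r).code then
          (rectFamily d L N τ r).lipC * ((rectFamily d L N τ r).letters.length : ℝ) else 0)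
      = ∑ p : DirPair d, ∑ x : Site d L,
          (if e.1 ∈ rectCode x p.1.1 p.1.2 then |τ| / Real.sqrt N * (6 : ℝ) else 0) := by
        rw [Fintype.sum_prod_type_right]
        simp only [rectFamily_code, rectFamily_lipC, rectFamily_letters, length_rectWord, Nat.cast_ofNat]
    _ ≤ ∑ _p : DirPair d, 30 * (|τ| / Real.sqrt N) := sum_le_sum fun p _ => hinner p
    _ = 30 * (d : ℝ) * ((d : ℝ) - 1) * |τ| / Real.sqrt N := by
        rw [sum_const, card_univ, card_dirPair, nsmul_eq_mul]
        push_cast [Nat.cast_sub hd]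
        ring

end Family

/-! ### The witness -/

/-- The tier-1 ball is monotone in its radii. [folklore] -/
theorem clusterDomainFR_mono [NeZero L] {ε₀ ε₁ ε₀' ε₁' : ℝ} {r : ℕ} (h₀ : ε₀ ≤ ε₀') (h₁ : ε₁ ≤ ε₁')
    {W : Perturbation d L N} (hW : W ∈ ClusterDomainFR ε₀ ε₁ r) : W ∈ ClusterDomainFR ε₀' ε₁' r := by
  obtain ⟨hr, w, hw₀, hw₁⟩ := hW
  exact ⟨hr, w, fun e => (hw₀ e).trans h₀, fun e => (hw₁ e).trans h₁⟩


section Witness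

variable [NeZero L] (N : ℕ) (τ : ℝ)

/-- **Total** of the rectangle perturbation: the typed `1×2`-rectangle action `Σ_x Σ_{i ≠ j} τ(1 − Re tr U_∂r/N)`.
[folklore] -/
theorem total_rectFamily (U : GaugeConfig d L (SUN N)) :
    (termPerturbation (rectFamily d L N τ)).total U =
      ∑ x : Site d L, ∑ i, ∑ j, if i = j then 0 else rectangleActivity N τ x i j U := by
  rw [total_termPerturbation, Fintype.sum_prod_type]
  refine sum_congr rfl fun x _ => ?_
  have h1 : ∑ y : DirPair d, (rectFamily d L N τ (x, y)).act U =
      ∑ q ∈ univ.filter (fun q : Fin d × Fin d => q.1 ≠ q.2), rectangleActivity N τ x q.1 q.2 U := by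
    rw [Finset.sum_subtype (univ.filter (fun q : Fin d × Fin d => q.1 ≠ q.2)) (p := fun q : Fin d × Fin d => q.1 ≠ q.2)
      (fun q => by simp) (fun q => rectangleActivity N τ x q.1 q.2 U)]
    exact sum_congr rfl fun y _ => rectFamily_act N τ (x, y) U
  rw [h1, sum_filter, Fintype.sum_prod_type]
  refine sum_congr rfl fun i _ => sum_congr rfl fun j _ => ?_
  exact ite_not _ _ _

/-- **Membership** (landed, site-based incidence): the rectangle perturbation lies in
`ClusterDomainFR (12(d−1)|τ|) (30 d (d−1)|τ|/√N) 2`. [folklore] -/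
theorem rectFamily_mem_clusterDomainFR :
    termPerturbation (rectFamily d L N τ) ∈
      ClusterDomainFR (12 * ((d : ℝ) - 1) * |τ|) (30 * (d : ℝ) * ((d : ℝ) - 1) * |τ| / Real.sqrt N) 2 := by
  refine termPerturbation_mem_clusterDomainFR (rectFamily d L N τ)
    (fun r => polymerDiam_rectCode_le r.2.2) (fun e => ?_) (fun e => sum_site_rectFamily_le N τ e)
  simp only [rectFamily_oscC, rectFamily_letters]
  rw [← mul_sum, sum_mult_rectFamily_real]
  linarith

/-- **Vertical dependence diameter `2`** of the rectangle perturbation (`3 ≤ L`). [folklore] -/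
theorem hasVertRange_rectFamily (hL : 3 ≤ L) : HasVertRange 2 (termPerturbation (rectFamily d L N τ)) :=
  hasVertRange_termPerturbation (rectFamily d L N τ) (rectFamily_code_injective N τ hL) fun r v =>
    window_rectWord r.2.2 v

/-- **Slab-locality** of the rectangle perturbation: centre-slab invariant (balanced loops) with vertical
dependence diameter `2` (`3 ≤ L`). [folklore] -/
theorem isSlabLocal_rectFamily (hL : 3 ≤ L) : IsSlabLocal 2 (termPerturbation (rectFamily d L N τ)) :=
  isSlabLocal_termPerturbation (rectFamily d L N τ)
    (fun r v t _z hz U => loopActivity_centerSlabRotate (netCount_rectWord r.2.2) τ v t hz U)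
    (rectFamily_code_injective N τ hL) fun r v => window_rectWord r.2.2 v

end Witness

/-- **NAMED ROW (rb-theory 2026-08-22T21:38Z, certified lineage rb)**: for `SU(2)`, `d = 4`, the `1×2`-rectangle
perturbation with `|τ| ≤ 1/2000` lies in the landed tier-1 ball `(ε₀, ε₁) = (13/50, 13/100)`, range `2` — the ball of
the quarter-door clustering row at `β_W = 1/8` — and is slab-local with vertical dependence diameter `2`
(`36|τ| ≤ 13/50`, `360|τ|/√2 ≤ 13/100` via `√2 ≥ 1.4142`). [folklore] -/
theorem su2_rectangle_member_one_eighth [NeZero L] (τ : ℝ) (hτ : |τ| ≤ 1 / 2000) (hL : 3 ≤ L) :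
    termPerturbation (rectFamily 4 L 2 τ) ∈ ClusterDomainFR (13 / 50) (13 / 100) 2 ∧
      HasVertRange 2 (termPerturbation (rectFamily 4 L 2 τ)) ∧ IsSlabLocal 2 (termPerturbation (rectFamily 4 L 2 τ)) := by
  refine ⟨clusterDomainFR_mono ?_ ?_ (rectFamily_mem_clusterDomainFR (d := 4) (L := L) 2 τ),
    hasVertRange_rectFamily 2 τ hL, isSlabLocal_rectFamily 2 τ hL⟩
  · norm_num; linarith
  · have hs : (1.4142 : ℝ) ≤ Real.sqrt 2 := by
      rw [show (1.4142 : ℝ) = Real.sqrt (1.4142 ^ 2) by rw [Real.sqrt_sq (by norm_num)]]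
      exact Real.sqrt_le_sqrt (by norm_num)
    have hs0 : 0 < Real.sqrt 2 := by positivity
    simp only [Nat.cast_ofNat]
    rw [div_le_iff₀ hs0]
    nlinarith [abs_nonneg τ]

/-- **T0.2 witness (w1): the `1×2`-rectangle action is in the LANDED tier-1 ball** (site-based incidence), with
the loads of `RobustBall/Targets.RectangleWitnessTargetC` AS TYPED: oscillation load `12(d−1)|τ|`, Lipschitz load
`30 d (d−1)|τ|/√N`, range `2`, vertical dependence diameter `2`, centre-slab invariant — for every coefficient `τ`, every
`N`, `d` and every torus `L ≥ 3`. (The reads-incidence numbers `36(d−1)|τ|/√N` of `RectangleWitnessTarget` belong to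
the upgrade ball of `RobustBall/FineBall`.) [folklore] -/
theorem rectangleWitnessTargetC_holds (N d : ℕ) : RectangleWitnessTargetC N d := by
  intro τ L _ hL
  exact ⟨termPerturbation (rectFamily d L N τ), total_rectFamily N τ, rectFamily_mem_clusterDomainFR N τ,
    hasVertRange_rectFamily N τ hL, isSlabLocal_rectFamily N τ hL⟩

end Summit.Ventures.YMGap.RobustBall

end
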